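import Summits.Ventures.PercRepro.S1DisjointSumTriangleNineFour
import Summits.Ventures.PercRepro.TheoremNAll

/-!
# PercRepro — THE `(6, 3)`-SPLIT CONSUMER AT `(9, 4)`: A RANK-6 PART ON 9 POINTS ⊕ A SIMPLE RANK-3 PART ON
5 POINTS (p2, gen 28; SUBCLAIM-S1 §6.10 (xvii)(j))

The first `1`-separable shape of the `(9, 5)` cell whose parts are NOT circuits: `M` of rank `6` on `9` points
(corank `3`) and `N` of rank `3` on `5` points (corank `2`) with every pair of distinct points of `N` of rank `2`
(simple, loopless). Then `#U(M ⊕ N; 9, 4) ≤ 10 N_M(6, 2) + 5 N_M(6, 3)` (the profile of `N`: `N_N(3, 0) ≤ 1`,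
`N_N(3, 1) ≤ 5`, `N_N(3, 2) ≤ 10`, `N_N(3, 3) = ∅`; and `N_M(6, 4) = ∅` on `9` points), while
`#Y(M ⊕ N; 9, 4) ≥ 26 f_M(3) + 31 f_M(4) + 32 f_M(5)` (`f_N(0) ≥ 1`, `f_N(1) ≥ 5`, `f_N(2) + f_N(3) ≥ 26`: every
set with at least two points has rank `2` or `3`). The cells `(6, 3)` of `M` (Theorem M on `9` points, `Φ = 3`)
and `(6, 2)` (Theorem N, `Φ = 13/2`) give `Φ(9, 4) · #U ≤ (84/6.5)(f_M(3) + f_M(4) + f_M(5)) + 14 (f_M(4) + f_M(5))`,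
below the `Y`-side term by term. No coloop-freeness, no double count. Nothing is claimed about any cell.

* `profileSet_eq_empty_of_ncard_lt`, `profileSet_eq_empty_of_eRank_lt_snd` — two emptiness lemmas;
* `phiK_six_two` — `Φ(6, 2) = 13/2`;
* the profile of a simple rank-3 matroid on 5 points: `eRk_singleton_eq_one_of_pairs`,
  `two_le_eRk_of_two_le_ncard`, `ncard_le_ncard_rankSet_one_of_pairs`, `ncard_rankSet_two_add_three_of_pairs`,
  `ncard_profileSet_three_zero_le_of_pairs`, `ncard_profileSet_three_one_le_of_pairs`,
  `ncard_profileSet_three_two_le_of_pairs`;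
* `ncard_U_disjointSum_six_three_le`, `ncard_Y_disjointSum_six_three_ge` — the two sides;
* **`c025_nine_four_disjointSum_six_three`** — the consumer.
Axioms: standard.
-/

open scoped Matroid

namespace PercRepro

namespace S1

open Set

variable {α : Type}

/-- A profile set `N(a, b)` is empty when `|E| < a + b` (a member would need `a` points and `b` more). -/
theorem profileSet_eq_empty_of_ncard_lt (M : Matroid α) [M.Finite] {a b : ℕ} (h : M.E.ncard < a + b) :
    profileSet M a b = ∅ := by
  rw [eq_empty_iff_forall_notMem]
  rintro A ⟨hA, hp, hq⟩
  have hAfin : A.Finite := M.ground_finite.subset hA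
  have h1 : (a : ℕ∞) ≤ A.ncard := by
    rw [← hp, hAfin.cast_ncard_eq]; exact M.eRk_le_encard A
  have h2 : (b : ℕ∞) ≤ (M.E \ A).ncard := by
    rw [← hq, (M.ground_finite.subset sdiff_subset).cast_ncard_eq]; exact M.eRk_le_encard _
  have h3 : A.ncard + (M.E \ A).ncard = M.E.ncard := by
    rw [← ncard_union_eq disjoint_sdiff_right hAfin (M.ground_finite.subset sdiff_subset),
      union_sdiff_cancel hA]
  have h1' : a ≤ A.ncard := by exact_mod_cast h1
  have h2' : b ≤ (M.E \ A).ncard := by exact_mod_cast h2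
  omega

/-- A profile set `N(a, b)` is empty when `b` exceeds the rank. -/
theorem profileSet_eq_empty_of_eRank_lt_snd (M : Matroid α) {r b : ℕ} (hr : M.eRank = r) (hb : r < b) (a : ℕ) :
    profileSet M a b = ∅ := by
  rw [eq_empty_iff_forall_notMem]
  rintro A ⟨-, -, hA⟩
  have h := M.eRk_le_eRank (M.E \ A)
  rw [hA, hr] at h
  have h' : b ≤ r := by exact_mod_cast h
  omega

/-- `Φ(6, 2) = 13/2`. -/
theorem phiK_six_two : phiK 6 2 = 13 / 2 := by
  unfold phiK
  rw [show Finset.Ioo 2 6 = {3, 4, 5} from by decide, show (6 : ℕ) + 2 = 8 from rfl]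
  rw [Finset.sum_insert (by decide), Finset.sum_insert (by decide), Finset.sum_singleton]
  rw [show Nat.choose 8 3 = 56 by decide, show Nat.choose 8 4 = 70 by decide,
    show Nat.choose 8 5 = 56 by decide, show Nat.choose 8 6 = 28 by decide]
  norm_num

section SimpleRankThree

variable {N : Matroid α} [N.Finite]

/-- When all pairs of distinct points have rank `2` and there are at least two points, every point has rank `1`
(no loops). -/
theorem eRk_singleton_eq_one_of_pairs (hpairs : ∀ e ∈ N.E, ∀ f ∈ N.E, e ≠ f → N.eRk {e, f} = 2)
    (h2 : 2 ≤ N.E.ncard) {e : α} (he : e ∈ N.E) : N.eRk {e} = 1 := by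
  have hne : (N.E \ {e}).Nonempty := by
    rw [← ncard_pos (N.ground_finite.subset sdiff_subset), ncard_sdiff_singleton_of_mem he]
    omega
  obtain ⟨f, hfE, hfe⟩ := hne
  have hfe' : e ≠ f := fun h => hfe (by rw [mem_singleton_iff]; exact h.symm)
  have hp := hpairs e he f hfE hfe'
  have hle : N.eRk {e} ≤ 1 := by
    have := N.eRk_le_encard {e}
    rwa [encard_singleton] at this
  have hf1 : N.eRk {f} ≤ 1 := by
    have := N.eRk_le_encard {f}
    rwa [encard_singleton] at this
  have hu := N.eRk_union_le_eRk_add_eRk {e} {f}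
  rw [singleton_union, hp] at hu
  obtain ⟨n, hn⟩ := ENat.ne_top_iff_exists.mp (ne_top_of_le_ne_top (by decide) hle)
  obtain ⟨m, hm⟩ := ENat.ne_top_iff_exists.mp (ne_top_of_le_ne_top (by decide) hf1)
  rw [← hn] at hle hu ⊢
  rw [← hm] at hf1 hu
  have hle' : n ≤ 1 := by exact_mod_cast hle
  have hf1' : m ≤ 1 := by exact_mod_cast hf1
  have hu' : 2 ≤ n + m := by exact_mod_cast hu
  have hn1 : n = 1 := by omega
  rw [hn1]
  rfl

/-- Every set with at least two points has rank at least `2` when all pairs do. -/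
theorem two_le_eRk_of_two_le_ncard (hpairs : ∀ e ∈ N.E, ∀ f ∈ N.E, e ≠ f → N.eRk {e, f} = 2) {A : Set α}
    (hA : A ⊆ N.E) (h2 : 2 ≤ A.ncard) : 2 ≤ N.eRk A := by
  have hAfin : A.Finite := N.ground_finite.subset hA
  have hpos : 0 < A.ncard := by omega
  obtain ⟨e, he⟩ := (ncard_pos hAfin).mp hpos
  have h1 : 0 < (A \ {e}).ncard := by
    rw [ncard_sdiff_singleton_of_mem he]; omega
  obtain ⟨f, hf⟩ := (ncard_pos (hAfin.subset sdiff_subset)).mp h1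
  have hef : e ≠ f := fun h => hf.2 (by rw [mem_singleton_iff]; exact h.symm)
  have hsub : ({e, f} : Set α) ⊆ A := by
    intro x hx
    rcases hx with rfl | rfl
    · exact he
    · exact hf.1
  rw [← hpairs e (hA he) f (hA hf.1) hef]
  exact N.eRk_mono hsub

/-- `f_N(1) ≥ |E|`: every singleton has rank `1`. -/
theorem ncard_le_ncard_rankSet_one_of_pairs (hpairs : ∀ e ∈ N.E, ∀ f ∈ N.E, e ≠ f → N.eRk {e, f} = 2)
    (h2 : 2 ≤ N.E.ncard) : N.E.ncard ≤ (rankSet N 1).ncard := by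
  have hsub : {A : Set α | A ⊆ N.E ∧ A.ncard = 1} ⊆ rankSet N 1 := by
    rintro A ⟨hAE, hA1⟩
    obtain ⟨e, rfl⟩ := ncard_eq_one.mp hA1
    exact ⟨hAE, by rw [eRk_singleton_eq_one_of_pairs hpairs h2 (hAE (mem_singleton e))]; rfl⟩
  have h := ncard_le_ncard hsub (rankSet_finite N 1)
  rwa [ncard_setOf_subset_ncard_eq N.ground_finite 1, Nat.choose_one_right] at h

/-- `f_N(2) + f_N(3) ≥ 26` on `5` points of rank `3` with all pairs of rank `2`: every set with at least two
points has rank `2` or `3`, and there are `10 + 10 + 5 + 1` of them. -/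
theorem ncard_rankSet_two_add_three_of_pairs (hpairs : ∀ e ∈ N.E, ∀ f ∈ N.E, e ≠ f → N.eRk {e, f} = 2)
    (hN : N.eRank = ((3 : ℕ) : ℕ∞)) (hE : N.E.ncard = 5) :
    26 ≤ (rankSet N 2).ncard + (rankSet N 3).ncard := by
  have hfin : ∀ k : ℕ, {A : Set α | A ⊆ N.E ∧ A.ncard = k}.Finite := fun k =>
    N.ground_finite.finite_subsets.subset (fun _ hA => hA.1)
  have hcard : ∀ k : ℕ, {A : Set α | A ⊆ N.E ∧ A.ncard = k}.ncard = Nat.choose 5 k := fun k => by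
    rw [ncard_setOf_subset_ncard_eq N.ground_finite k, hE]
  have hdisj : ∀ k l : ℕ, k ≠ l →
      Disjoint {A : Set α | A ⊆ N.E ∧ A.ncard = k} {A : Set α | A ⊆ N.E ∧ A.ncard = l} := by
    intro k l hkl
    rw [Set.disjoint_left]
    rintro A ⟨-, hk⟩ ⟨-, hl⟩
    exact hkl (hk.symm.trans hl)
  -- the four layers lie in the two rank levels
  have hsub : {A : Set α | A ⊆ N.E ∧ A.ncard = 2} ∪ {A : Set α | A ⊆ N.E ∧ A.ncard = 3} ∪
      {A : Set α | A ⊆ N.E ∧ A.ncard = 4} ∪ {A : Set α | A ⊆ N.E ∧ A.ncard = 5} ⊆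
      rankSet N 2 ∪ rankSet N 3 := by
    intro A hA
    have hAE : A ⊆ N.E := by
      rcases hA with ((h | h) | h) | h <;> exact h.1
    have h2 : 2 ≤ A.ncard := by
      rcases hA with ((⟨-, h⟩ | ⟨-, h⟩) | ⟨-, h⟩) | ⟨-, h⟩ <;> omega
    have hlo := two_le_eRk_of_two_le_ncard hpairs hAE h2
    have hhi := N.eRk_le_eRank A
    rw [hN] at hhi
    obtain ⟨n, hn⟩ := ENat.ne_top_iff_exists.mp (ne_top_of_le_ne_top (by decide) hhi)
    rw [← hn] at hlo hhi
    have hlo' : 2 ≤ n := by exact_mod_cast hlo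
    have hhi' : n ≤ 3 := by exact_mod_cast hhi
    rcases Nat.lt_or_ge n 3 with h3 | h3
    · left
      refine ⟨hAE, ?_⟩
      rw [← hn]
      have : n = 2 := by omega
      rw [this]
    · right
      refine ⟨hAE, ?_⟩
      rw [← hn]
      have : n = 3 := by omega
      rw [this]
  have hunion : ({A : Set α | A ⊆ N.E ∧ A.ncard = 2} ∪ {A : Set α | A ⊆ N.E ∧ A.ncard = 3} ∪
      {A : Set α | A ⊆ N.E ∧ A.ncard = 4} ∪ {A : Set α | A ⊆ N.E ∧ A.ncard = 5}).ncard = 26 := by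
    rw [ncard_union_eq (Set.disjoint_union_left.mpr ⟨Set.disjoint_union_left.mpr
        ⟨hdisj 2 5 (by norm_num), hdisj 3 5 (by norm_num)⟩, hdisj 4 5 (by norm_num)⟩)
        (((hfin 2).union (hfin 3)).union (hfin 4)) (hfin 5),
      ncard_union_eq (Set.disjoint_union_left.mpr ⟨hdisj 2 4 (by norm_num), hdisj 3 4 (by norm_num)⟩)
        ((hfin 2).union (hfin 3)) (hfin 4),
      ncard_union_eq (hdisj 2 3 (by norm_num)) (hfin 2) (hfin 3), hcard 2, hcard 3, hcard 4, hcard 5]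
    decide
  have h := ncard_le_ncard hsub ((rankSet_finite N 2).union (rankSet_finite N 3))
  rw [hunion, ncard_union_eq (rankSet_disjoint_of_ne N (by norm_num)) (rankSet_finite N 2)
    (rankSet_finite N 3)] at h
  exact h

/-- `N_N(3, 0) ≤ 1`: a complement of rank `0` is empty when there are no loops. -/
theorem ncard_profileSet_three_zero_le_of_pairs (hpairs : ∀ e ∈ N.E, ∀ f ∈ N.E, e ≠ f → N.eRk {e, f} = 2)
    (h2 : 2 ≤ N.E.ncard) : (profileSet N 3 0).ncard ≤ 1 := by
  have hsub : profileSet N 3 0 ⊆ {N.E} := by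
    rintro A ⟨hAE, -, hAc⟩
    rw [mem_singleton_iff]
    refine hAE.antisymm (fun x hx => ?_)
    by_contra hxA
    have hx1 := eRk_singleton_eq_one_of_pairs hpairs h2 hx
    have hsub' : ({x} : Set α) ⊆ N.E \ A := singleton_subset_iff.mpr (show x ∈ N.E \ A from ⟨hx, hxA⟩)
    have hle := N.eRk_mono hsub'
    rw [hx1, hAc] at hle
    exact absurd hle (by decide)
  exact (ncard_le_ncard hsub (finite_singleton _)).trans (by rw [ncard_singleton])

/-- `N_N(3, 1) ≤ |E|`: a complement of rank `1` is a single point when all pairs have rank `2`. -/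
theorem ncard_profileSet_three_one_le_of_pairs (hpairs : ∀ e ∈ N.E, ∀ f ∈ N.E, e ≠ f → N.eRk {e, f} = 2) :
    (profileSet N 3 1).ncard ≤ N.E.ncard := by
  have hsub : profileSet N 3 1 ⊆ (fun x => N.E \ {x}) '' N.E := by
    rintro A ⟨hAE, -, hAc⟩
    have hfin : (N.E \ A).Finite := N.ground_finite.subset sdiff_subset
    have hne : (N.E \ A).Nonempty := by
      rw [nonempty_iff_ne_empty]
      rintro h0
      rw [h0, N.eRk_empty] at hAc
      exact absurd hAc (by decide)
    obtain ⟨x, hx⟩ := hne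
    refine ⟨x, hx.1, ?_⟩
    show N.E \ {x} = A
    ext y
    constructor
    · rintro ⟨hyE, hyx⟩
      by_contra hyA
      have hxy : x ≠ y := fun h => hyx (by rw [mem_singleton_iff]; exact h.symm)
      have hp := hpairs x hx.1 y hyE hxy
      have hle := N.eRk_mono (show ({x, y} : Set α) ⊆ N.E \ A from by
        intro z hz
        rcases hz with rfl | rfl
        · exact hx
        · exact ⟨hyE, hyA⟩)
      rw [hp, hAc] at hle
      exact absurd hle (by decide)
    · intro hyA
      exact ⟨hAE hyA, fun hyx => hx.2 (by rw [mem_singleton_iff] at hyx; rw [← hyx]; exact hyA)⟩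
  exact (ncard_le_ncard hsub (N.ground_finite.image _)).trans (ncard_image_le N.ground_finite)

/-- `N_N(3, 2) ≤ C(|E|, 3)` on `5` points: a spanning set with a rank-`2` complement has exactly `3` points. -/
theorem ncard_profileSet_three_two_le_of_pairs (hE : N.E.ncard = 5) : (profileSet N 3 2).ncard ≤ 10 := by
  have hsub : profileSet N 3 2 ⊆ {A : Set α | A ⊆ N.E ∧ A.ncard = 3} := by
    rintro A ⟨hAE, hA3, hAc⟩
    refine ⟨hAE, ?_⟩
    have hAfin : A.Finite := N.ground_finite.subset hAE
    have h1 : ((3 : ℕ) : ℕ∞) ≤ (A.ncard : ℕ∞) := by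
      rw [← hA3, hAfin.cast_ncard_eq]; exact N.eRk_le_encard A
    have h2 : ((2 : ℕ) : ℕ∞) ≤ ((N.E \ A).ncard : ℕ∞) := by
      rw [← hAc, (N.ground_finite.subset sdiff_subset).cast_ncard_eq]; exact N.eRk_le_encard _
    have h3 : A.ncard + (N.E \ A).ncard = N.E.ncard := by
      rw [← ncard_union_eq disjoint_sdiff_right hAfin (N.ground_finite.subset sdiff_subset),
        union_sdiff_cancel hAE]
    have h1' : 3 ≤ A.ncard := by exact_mod_cast h1
    have h2' : 2 ≤ (N.E \ A).ncard := by exact_mod_cast h2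
    omega
  have h := ncard_le_ncard hsub (N.ground_finite.finite_subsets.subset (fun _ hA => hA.1))
  rwa [ncard_setOf_subset_ncard_eq N.ground_finite 3, hE, show Nat.choose 5 3 = 10 by decide] at h

end SimpleRankThree

/-- **The `U`-side of the `(6, 3)` split**: `#U(M ⊕ N; 9, 4) ≤ 10 N_M(6, 2) + 5 N_M(6, 3)`. -/
theorem ncard_U_disjointSum_six_three_le (M N : Matroid α) [M.Finite] [N.Finite] (h : Disjoint M.E N.E)
    (hM : M.eRank = ((6 : ℕ) : ℕ∞)) (hME : M.E.ncard = 9) (hN : N.eRank = ((3 : ℕ) : ℕ∞))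
    (hNE : N.E.ncard = 5) (hpairs : ∀ e ∈ N.E, ∀ f ∈ N.E, e ≠ f → N.eRk {e, f} = 2) :
    {A : Set α | A ⊆ (M.disjointSum N h).E ∧ (M.disjointSum N h).eRk A = ((9 : ℕ) : ℕ∞) ∧
        (M.disjointSum N h).eRk ((M.disjointSum N h).E \ A) = ((4 : ℕ) : ℕ∞)}.ncard ≤
      10 * (profileSet M 6 2).ncard + 5 * (profileSet M 6 3).ncard := by
  rw [disjointSum_ncard_U_eq_finsum M N h 9 4, finsum_mem_coe_finset]
  rw [Finset.sum_eq_add_of_mem (6, 2) (6, 3) (by decide) (by decide) (by decide) ?_]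
  · dsimp only
    rw [show (9 : ℕ) - 6 = 3 from rfl, show (4 : ℕ) - 2 = 2 from rfl, show (4 : ℕ) - 3 = 1 from rfl]
    have h2 := ncard_profileSet_three_two_le_of_pairs (N := N) hNE
    have h1 := ncard_profileSet_three_one_le_of_pairs hpairs
    rw [hNE] at h1
    calc (profileSet M 6 2).ncard * (profileSet N 3 2).ncard + (profileSet M 6 3).ncard * (profileSet N 3 1).ncard
        ≤ (profileSet M 6 2).ncard * 10 + (profileSet M 6 3).ncard * 5 :=
          Nat.add_le_add (Nat.mul_le_mul_left _ h2) (Nat.mul_le_mul_left _ h1)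
      _ = 10 * (profileSet M 6 2).ncard + 5 * (profileSet M 6 3).ncard := by ring
  · rintro ⟨a, b⟩ hmem ⟨hne1, hne2⟩
    rw [Finset.mem_product, Finset.mem_range, Finset.mem_range] at hmem
    dsimp only
    rcases Nat.lt_or_ge 6 a with ha | ha
    · rw [profileSet_eq_empty_of_eRank_lt M hM ha b, ncard_empty, zero_mul]
    rcases Nat.lt_or_ge a 6 with ha' | ha'
    · have h9a : 3 < 9 - a := by omega
      rw [profileSet_eq_empty_of_eRank_lt N hN h9a (4 - b), ncard_empty, mul_zero]
    have ha6 : a = 6 := by omega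
    subst ha6
    rw [show (9 : ℕ) - 6 = 3 from rfl]
    rcases Nat.lt_or_ge b 2 with hb | hb
    · -- `b ≤ 1`: the `N`-complement would need `≥ 3` points beside a spanning set of `≥ 3` points
      have h5 : N.E.ncard < 3 + (4 - b) := by rw [hNE]; omega
      rw [profileSet_eq_empty_of_ncard_lt N h5, ncard_empty, mul_zero]
    · have hb4 : b = 4 := by
        rcases Nat.lt_or_ge b 4 with hb4 | hb4
        · exfalso
          rcases Nat.lt_or_ge b 3 with hb3 | hb3
          · exact hne1 (by congr 1; omega)
          · exact hne2 (by congr 1; omega)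
        · omega
      subst hb4
      -- `N_M(6, 4) = ∅` on `9` points
      rw [profileSet_eq_empty_of_ncard_lt M (by rw [hME]; norm_num : M.E.ncard < 6 + 4), ncard_empty,
        zero_mul]

/-- **The `Y`-side of the `(6, 3)` split**: `#Y(M ⊕ N; 9, 4) ≥ 26 f_M(3) + 31 f_M(4) + 32 f_M(5)`. -/
theorem ncard_Y_disjointSum_six_three_ge (M N : Matroid α) [M.Finite] [N.Finite] (h : Disjoint M.E N.E)
    (hN : N.eRank = ((3 : ℕ) : ℕ∞)) (hNE : N.E.ncard = 5)
    (hpairs : ∀ e ∈ N.E, ∀ f ∈ N.E, e ≠ f → N.eRk {e, f} = 2) :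
    26 * (rankSet M 3).ncard + 31 * (rankSet M 4).ncard + 32 * (rankSet M 5).ncard ≤
      {A : Set α | A ⊆ (M.disjointSum N h).E ∧ ((4 : ℕ) : ℕ∞) < (M.disjointSum N h).eRk A ∧
        (M.disjointSum N h).eRk A < ((9 : ℕ) : ℕ∞)}.ncard := by
  rw [disjointSum_ncard_Y_eq_finsum M N h 9 4, finsum_mem_coe_finset]
  have hsub : ({(3, 2), (3, 3), (4, 1), (4, 2), (4, 3), (5, 0), (5, 1), (5, 2), (5, 3)} : Finset (ℕ × ℕ)) ⊆
      (Finset.range 9 ×ˢ Finset.range 9).filter (fun x : ℕ × ℕ => 4 < x.1 + x.2 ∧ x.1 + x.2 < 9) := by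
    decide
  refine le_trans ?_ (Finset.sum_le_sum_of_subset hsub)
  rw [Finset.sum_insert (by decide), Finset.sum_insert (by decide), Finset.sum_insert (by decide),
    Finset.sum_insert (by decide), Finset.sum_insert (by decide), Finset.sum_insert (by decide),
    Finset.sum_insert (by decide), Finset.sum_insert (by decide), Finset.sum_singleton]
  dsimp only
  have f0 : 1 ≤ (rankSet N 0).ncard := by
    have h0 : (∅ : Set α) ∈ rankSet N 0 := ⟨empty_subset _, by rw [N.eRk_empty]; rfl⟩
    exact (ncard_pos (rankSet_finite N 0)).mpr ⟨∅, h0⟩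
  have f1 : 5 ≤ (rankSet N 1).ncard := by
    have := ncard_le_ncard_rankSet_one_of_pairs hpairs (by omega)
    rwa [hNE] at this
  have f23 := ncard_rankSet_two_add_three_of_pairs hpairs hN hNE
  have e3 := Nat.mul_le_mul_left (rankSet M 3).ncard f23
  have e4 := Nat.mul_le_mul_left (rankSet M 4).ncard f23
  have e5 := Nat.mul_le_mul_left (rankSet M 5).ncard f23
  rw [mul_add] at e3 e4 e5
  have e41 := Nat.mul_le_mul_left (rankSet M 4).ncard f1
  have e50 := Nat.mul_le_mul_left (rankSet M 5).ncard f0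
  have e51 := Nat.mul_le_mul_left (rankSet M 5).ncard f1
  linarith

/-- The arithmetic of the `(6, 3)`-split consumer: `u ≤ 10 P₂ + 5 P₃`, `(13/2) P₂ ≤ f₃ + f₄ + f₅`,
`3 P₃ ≤ f₄ + f₅`, `y ≥ 26 f₃ + 31 f₄ + 32 f₅` give `(42/5) u ≤ y`. -/
theorem consumer_arith_six_three {u y P2 P3 f3 f4 f5 : ℚ} (hU : u ≤ 10 * P2 + 5 * P3)
    (h62 : 13 / 2 * P2 ≤ f3 + f4 + f5) (h63 : 3 * P3 ≤ f4 + f5) (hY : 26 * f3 + 31 * f4 + 32 * f5 ≤ y)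
    (hf3 : 0 ≤ f3) (hf4 : 0 ≤ f4) (hf5 : 0 ≤ f5) : 42 / 5 * u ≤ y := by
  linarith

/-- **THE `(6, 3)`-SPLIT CONSUMER**: `Φ(9, 4) · #U(M ⊕ N; 9, 4) ≤ #Y(M ⊕ N; 9, 4)` for every finite `M` of rank
`6` on `9` points and every finite `N` of rank `3` on `5` points whose pairs of distinct points all have rank
`2` — from Theorem M at `(6, 3)` and Theorem N at `(6, 2)` on `M`. -/
theorem c025_nine_four_disjointSum_six_three (M N : Matroid α) [M.Finite] [N.Finite]
    (h : Disjoint M.E N.E) (hM : M.eRank = ((6 : ℕ) : ℕ∞)) (hME : M.E.ncard = 9)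
    (hN : N.eRank = ((3 : ℕ) : ℕ∞)) (hNE : N.E.ncard = 5)
    (hpairs : ∀ e ∈ N.E, ∀ f ∈ N.E, e ≠ f → N.eRk {e, f} = 2) :
    phiK 9 4 * ({A : Set α | A ⊆ (M.disjointSum N h).E ∧ (M.disjointSum N h).eRk A = ((9 : ℕ) : ℕ∞) ∧
        (M.disjointSum N h).eRk ((M.disjointSum N h).E \ A) = ((4 : ℕ) : ℕ∞)}.ncard : ℚ) ≤
      ({A : Set α | A ⊆ (M.disjointSum N h).E ∧ ((4 : ℕ) : ℕ∞) < (M.disjointSum N h).eRk A ∧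
        (M.disjointSum N h).eRk A < ((9 : ℕ) : ℕ∞)}.ncard : ℚ) := by
  have hU := ncard_U_disjointSum_six_three_le M N h hM hME hN hNE hpairs
  have hY := ncard_Y_disjointSum_six_three_ge M N h hN hNE hpairs
  have h63 : (3 : ℚ) * ((profileSet M 6 3).ncard : ℚ) ≤
      ((rankSet M 4).ncard : ℚ) + ((rankSet M 5).ncard : ℚ) := by
    have h0 := ThmN.RLS_of_ncard_eq M (p := 6) (q := 3) hME
    unfold ThmN.RLS at h0
    rw [phiK_six_three, ySet_eq_rankSet_union_of_eq M (q := 3) (p := 6) (k := 4) (k' := 5) rfl rfl rfl,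
      ncard_union_eq (rankSet_disjoint_of_ne M (by norm_num)) (rankSet_finite M 4) (rankSet_finite M 5)] at h0
    push_cast at h0
    exact h0
  have h62 : (13 / 2 : ℚ) * ((profileSet M 6 2).ncard : ℚ) ≤
      ((rankSet M 3).ncard : ℚ) + ((rankSet M 4).ncard : ℚ) + ((rankSet M 5).ncard : ℚ) := by
    have h0 := ThmN.c025_two_all M 6 (by norm_num)
    unfold ThmN.RLS at h0
    rw [phiK_six_two,
      ySet_eq_rankSet_union3_of_eq M (q := 2) (p := 6) (k := 3) (k' := 4) (k'' := 5) rfl rfl rfl rfl,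
      ncard_union_eq (Set.disjoint_union_left.mpr
        ⟨rankSet_disjoint_of_ne M (by norm_num), rankSet_disjoint_of_ne M (by norm_num)⟩)
        ((rankSet_finite M 3).union (rankSet_finite M 4)) (rankSet_finite M 5),
      ncard_union_eq (rankSet_disjoint_of_ne M (by norm_num)) (rankSet_finite M 3) (rankSet_finite M 4)] at h0
    push_cast at h0
    exact h0
  rw [phiK_nine_four]
  have hU' : (({A : Set α | A ⊆ (M.disjointSum N h).E ∧ (M.disjointSum N h).eRk A = ((9 : ℕ) : ℕ∞) ∧
      (M.disjointSum N h).eRk ((M.disjointSum N h).E \ A) = ((4 : ℕ) : ℕ∞)}.ncard : ℕ) : ℚ) ≤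
      10 * ((profileSet M 6 2).ncard : ℚ) + 5 * ((profileSet M 6 3).ncard : ℚ) := by
    exact_mod_cast hU
  have hY' : 26 * ((rankSet M 3).ncard : ℚ) + 31 * ((rankSet M 4).ncard : ℚ) + 32 * ((rankSet M 5).ncard : ℚ) ≤
      (({A : Set α | A ⊆ (M.disjointSum N h).E ∧ ((4 : ℕ) : ℕ∞) < (M.disjointSum N h).eRk A ∧
        (M.disjointSum N h).eRk A < ((9 : ℕ) : ℕ∞)}.ncard : ℕ) : ℚ) := by
    exact_mod_cast hY
  exact consumer_arith_six_three hU' h62 h63 hY' (Nat.cast_nonneg _) (Nat.cast_nonneg _) (Nat.cast_nonneg _)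

end S1

end PercRepro
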